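import Literature.Computability.QuantumComplexity.PauliPathIntegral
import Literature.Computability.QuantumComplexity.PauliRotationPropagation
import Literature.Analysis.Matrix.HoffmanWielandt
import HarnessLib

/-!
# Pauli-weight truncation of noisy Heisenberg observables: the normalized Frobenius norm, the
# low-weight projection, one-layer noise damping, and the computational-basis error average

Topic `Literature/Computability/QuantumComplexity`, sub-namespace `PauliPath` (the noisy layered
circuits of `PauliPathIntegral.lean`). Cell `qa-dq` (QA-DQ census row DQ-N3 «Pauli-path /
noise-induced simulability of expectation values»): this file fixes, over the tree's EXISTING
vocabulary (`pauliString`, `pauliCoeff` of `PauliExpansion.lean`; `strWeight`, `depolarizeAll`,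
`noisyValue`, `proj` of `PauliPathIntegral.lean`; `PauliPropagation.truncateTo` of
`PauliRotationPropagation.lean`; `HoffmanWielandt.frobSqNorm` of
`Literature/Analysis/Matrix/HoffmanWielandt.lean`), the OBJECTS in which the 2023–26 low-weight
Pauli-propagation theorems are stated, together with the elementary DETERMINISTIC lemmas those
proofs iterate. Nothing here is a running-time statement and no named fact is introduced.

HONEST FRAMING (cell charter): nothing here proves or refutes quantum advantage; these are finite
matrix identities / inequalities for an arbitrary finite register and arbitrary layer matrices.
## Sources (read on the page; tex chunks of `lit read arxiv:2407.12768`, `arxiv:2211.03999`)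

* [SchusterEtAl2024] T. Schuster, C. Yin, X. Gao, N. Y. Yao, *A polynomial-time classical algorithm
  for noisy quantum circuits*, arXiv:2407.12768, §2: "we utilize the normalized Frobenius norm,
  `‖O‖_F² = (1/2ⁿ) tr(O†O)`" (chunk p0005 L7); **Lemma 1** "Consider a low-average ensemble
  `𝓔 = {ρ}` and two observables `O` and `Õ`. The root-mean-square difference between the
  expectation value of `O` and `Õ` is less than `‖O − Õ‖_F`" (p0005 L44–46), where "any complete
  basis of states" such as "the ensemble of computational basis states" is low-average (p0005 L9);
  §2.1: the algorithm "estimates the expectation value `tr(𝒞{ρ}O) = tr(ρ 𝒞†{O})` by computing an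
  approximation `Õ` of the Heisenberg time-evolved observable `𝒞†{O}`" (p0005 L15) by keeping
  low-weight Pauli paths; §2.2: "`𝒫_{>ℓ} = Σ_{w=ℓ+1}^{n} 𝒫_w`", "`𝒫_w` projects onto Pauli
  operators of weight `w`" (p0005 L70, p0006 L48) and "a single application of uniform depolarizing
  noise damps the norm of any operator with weight above `ℓ` by at least `e^{−γ(ℓ+1)}`" (p0006 L56;
  their `γ` is the damping EXPONENT, "a Pauli operator `P` with weight `w[P]` is damped by an amount
  `e^{−γ w[P]}`", p0004 L32 — i.e. `e^{−γ_SYGY} = 1 − γ` for the tree's depolarizing rate `γ`).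
* [AharonovEtAl2023] D. Aharonov, X. Gao, Z. Landau, Y. Liu, U. Vazirani, STOC 2023 =
  arXiv:2211.03999, §2 Definition 2 and the display after it (`f̃ = (1−γ)^{|s|} f`): the noise layer
  `ℰ^{⊗n}` and its diagonal action on Pauli strings (the tree's `depolarizeAll_pauliString`).
* [RudolphEtAl2025] M. S. Rudolph et al., *Pauli Propagation*, arXiv:2505.21606, Theory Box 3 (weight
  truncation = one kept label set `K` of the tree's `truncateTo`) and §III C ("`2^{−n}Tr[O²] = Σ_α c_α²`").

## Contents (all proved; 0 named facts)

`frobSq` (normalized squared Frobenius norm, a rescaling of `HoffmanWielandt.frobSqNorm`) with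
Parseval `frobSq_eq_sum_pauliCoeff`, `frobSq_pauliString`, unitary invariance; the Pythagoras split
`frobSq_eq_frobSq_truncateTo_add` for the tree's `truncateTo`; `lowWeight ℓ`, `truncWeight ℓ = 𝒫_{≤ℓ}`
and their coefficient formulas; **one noise layer damps the high-weight mass**
(`frobSq_depolarizeAll_sub_truncWeight_le`: `‖𝒫_{>ℓ} ℰ^{⊗n}M‖_F² ≤ (1−γ)^{2(ℓ+1)}‖𝒫_{>ℓ}M‖_F²`);
**Lemma 1 for the basis ensemble** (`avg_norm_diag_sq_le_frobSq`: `2^{−n}Σ_x|⟨x|A|x⟩|² ≤ ‖A‖_F²`);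
the **noisy Heisenberg operator** `heis γ U O = 𝒞†{O}` with `trace_heis_mul`
(`Tr(heis·ρ) = noisyValue γ U ρ O`), `frobSq_heis_le` (`‖𝒞†{O}‖_F ≤ ‖O‖_F`) and
`avg_sq_error_le_frobSq` (for ANY approximant `Õ`: `2^{−n}Σ_x|p̃_O(x) − Tr(Õ|x⟩⟨x|)|² ≤ ‖𝒞†{O} − Õ‖_F²`).

## Deliberately NOT here

Running-time / algorithm statements (Theorems 1–4 of [SchusterEtAl2024] quantify over algorithms with
real-number inputs); low-average ensembles in general (Supplementary §II, not held: acq-13564; the basis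
ensemble is the special case here — TODO(general form)); the multi-layer truncation-error theorems
(Supp. §III–IV) and gate-based noise. These lemmas are the layer-by-layer ingredients only.
-/

noncomputable section

open Matrix Finset

namespace Literature.Computability.QuantumComplexity

namespace PauliPath

open Literature.Analysis.Matrix.HoffmanWielandt (frobSqNorm frobSqNorm_nonneg frobSqNorm_unitary_mul
  frobSqNorm_mul_unitary)
open PauliPropagation (truncateTo pauliCoeff_truncateTo)

variable {ι : Type*} [Fintype ι] [DecidableEq ι]

/-! ### The normalized Frobenius norm -/
/-- The **normalized squared Frobenius norm** `‖M‖_F² = 2^{−n} Σ_{x,y} |M_{xy}|² = 2^{−n} tr(M†M)`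
on an `n = |ι|`-qubit register (a rescaling of `HoffmanWielandt.frobSqNorm`).
[cite: SchusterEtAl2024, §2 (after Theorem 2: "‖O‖_F² = 2^{-n} tr(O†O)")] -/
def frobSq (M : Matrix (ι → Bool) (ι → Bool) ℂ) : ℝ :=
  ((2 : ℝ) ^ Fintype.card ι)⁻¹ * frobSqNorm M

/-- Unfolding of `frobSq`. [cite: SchusterEtAl2024, §2 (after Theorem 2)] -/
theorem frobSq_eq (M : Matrix (ι → Bool) (ι → Bool) ℂ) :
    frobSq M = ((2 : ℝ) ^ Fintype.card ι)⁻¹ * ∑ x, ∑ y, ‖M x y‖ ^ 2 := rfl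

/-- `‖M‖_F² ≥ 0`. [cite: HornJohnson2013, §5.6 (Frobenius norm)] -/
theorem frobSq_nonneg (M : Matrix (ι → Bool) (ι → Bool) ℂ) : 0 ≤ frobSq M :=
  mul_nonneg (by positivity) (frobSqNorm_nonneg M)

/-- **Parseval for the normalized norm**: `‖M‖_F² = 4^{−n} Σ_S |Tr(S M)|²` (the Pauli strings are an
orthogonal basis with `Tr(S S') = 2ⁿ[S = S']`; "`2^{−n}Tr[O²] = Σ_α c_α²`" for the normalized
coefficients `c_α = 2^{−n} Tr(P_α O)`). [cite: RudolphEtAl2025, §III C (2-norm = Σ c_α²)] -/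
theorem frobSq_eq_sum_pauliCoeff (M : Matrix (ι → Bool) (ι → Bool) ℂ) :
    frobSq M = ((4 : ℝ) ^ Fintype.card ι)⁻¹ * ∑ S : ι → Pauli, ‖pauliCoeff M S‖ ^ 2 := by
  rw [frobSq_eq, sum_norm_pauliCoeff_sq, ← mul_assoc,
    show (4 : ℝ) ^ Fintype.card ι = 2 ^ Fintype.card ι * 2 ^ Fintype.card ι by
      rw [← mul_pow]; norm_num]
  congr 1
  have h2 : (2 : ℝ) ^ Fintype.card ι ≠ 0 := pow_ne_zero _ two_ne_zero
  field_simp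

/-- A single Pauli string has normalized norm `1`. [cite: RudolphEtAl2025, §III C] -/
theorem frobSq_pauliString (S : ι → Pauli) : frobSq (pauliString S) = 1 := by
  rw [frobSq_eq_sum_pauliCoeff]
  have hc : ∀ T : ι → Pauli, ‖pauliCoeff (pauliString S) T‖ ^ 2 =
      if T = S then (4 : ℝ) ^ Fintype.card ι else 0 := by
    intro T
    rw [pauliCoeff_eq, trace_pauliString_mul_pauliString]
    split_ifs with h
    · rw [Complex.norm_pow, Complex.norm_two, ← pow_mul, show (4 : ℝ) = 2 ^ 2 by norm_num, ← pow_mul,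
        mul_comm]
    · simp
  simp only [hc, Finset.sum_ite_eq', Finset.mem_univ, if_true]
  exact inv_mul_cancel₀ (pow_ne_zero _ (by norm_num))

/-- **Unitary invariance**: `‖U M U†‖_F = ‖M‖_F` for `U†U = 1`.
[cite: SchusterEtAl2024, §2.2 (unitary layers move norm between weights without changing the total)] -/
theorem frobSq_unitary_conj {U : Matrix (ι → Bool) (ι → Bool) ℂ} (hU : Uᴴ * U = 1)
    (M : Matrix (ι → Bool) (ι → Bool) ℂ) : frobSq (U * M * Uᴴ) = frobSq M := by
  classical
  have hU' : U * Uᴴ = 1 := mul_eq_one_comm.mp hU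
  rw [frobSq, frobSq, frobSqNorm_mul_unitary (by rwa [conjTranspose_conjTranspose]),
    frobSqNorm_unitary_mul hU]

/-- **Unitary invariance, Heisenberg form**: `‖U† M U‖_F = ‖M‖_F` for `U†U = 1`.
[cite: SchusterEtAl2024, §2.2] -/
theorem frobSq_conjTranspose_conj {U : Matrix (ι → Bool) (ι → Bool) ℂ} (hU : Uᴴ * U = 1)
    (M : Matrix (ι → Bool) (ι → Bool) ℂ) : frobSq (Uᴴ * M * U) = frobSq M := by
  classical
  have hU' : U * Uᴴ = 1 := mul_eq_one_comm.mp hU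
  have h := frobSq_unitary_conj (U := Uᴴ) (by rwa [conjTranspose_conjTranspose]) M
  rwa [conjTranspose_conjTranspose] at h

/-! ### Truncation to a set of Pauli labels: the Pythagoras split -/

/-- The kept mass: `‖Π_K M‖_F² = 4^{−n} Σ_{S ∈ K} |Tr(S M)|²`.
[cite: RudolphEtAl2025, Theory Box 3 (truncation keeps the coefficients in K)] -/
theorem frobSq_truncateTo (K : Finset (ι → Pauli)) (M : Matrix (ι → Bool) (ι → Bool) ℂ) :
    frobSq (truncateTo K M) = ((4 : ℝ) ^ Fintype.card ι)⁻¹ * ∑ S ∈ K, ‖pauliCoeff M S‖ ^ 2 := by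
  rw [frobSq_eq_sum_pauliCoeff]
  congr 1
  rw [← Finset.sum_filter_add_sum_filter_not Finset.univ (· ∈ K)]
  have h1 : ∑ S ∈ Finset.univ.filter (· ∈ K), ‖pauliCoeff (truncateTo K M) S‖ ^ 2 =
      ∑ S ∈ K, ‖pauliCoeff M S‖ ^ 2 := by
    rw [Finset.filter_mem_eq_inter, Finset.univ_inter]
    exact Finset.sum_congr rfl fun S hS => by rw [pauliCoeff_truncateTo, if_pos hS]
  have h2 : ∑ S ∈ Finset.univ.filter (fun S => ¬ S ∈ K), ‖pauliCoeff (truncateTo K M) S‖ ^ 2 = 0 :=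
    Finset.sum_eq_zero fun S hS => by
      rw [pauliCoeff_truncateTo, if_neg (Finset.mem_filter.1 hS).2]; simp
  rw [h1, h2, add_zero]

/-- The discarded mass: `‖M − Π_K M‖_F² = 4^{−n} Σ_{S ∉ K} |Tr(S M)|²`.
[cite: RudolphEtAl2025, Theory Box 3 ("truncated Paulis")] -/
theorem frobSq_sub_truncateTo (K : Finset (ι → Pauli)) (M : Matrix (ι → Bool) (ι → Bool) ℂ) :
    frobSq (M - truncateTo K M) =
      ((4 : ℝ) ^ Fintype.card ι)⁻¹ * ∑ S ∈ Finset.univ \ K, ‖pauliCoeff M S‖ ^ 2 := by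
  have hsub : M - truncateTo K M = truncateTo (Finset.univ \ K) M := by
    refine eq_of_forall_pauliCoeff_eq fun T => ?_
    rw [pauliCoeff_sub, pauliCoeff_truncateTo, pauliCoeff_truncateTo]
    simp only [Finset.mem_sdiff, Finset.mem_univ, true_and]
    split_ifs <;> simp
  rw [hsub, frobSq_truncateTo]

/-- **Pythagoras**: `‖M‖_F² = ‖Π_K M‖_F² + ‖M − Π_K M‖_F²` (orthogonality of the Pauli strings).
[cite: RudolphEtAl2025, §III C and Theory Box 3] -/
theorem frobSq_eq_frobSq_truncateTo_add (K : Finset (ι → Pauli)) (M : Matrix (ι → Bool) (ι → Bool) ℂ) :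
    frobSq M = frobSq (truncateTo K M) + frobSq (M - truncateTo K M) := by
  rw [frobSq_truncateTo, frobSq_sub_truncateTo, frobSq_eq_sum_pauliCoeff, ← mul_add,
    ← Finset.sum_filter_add_sum_filter_not Finset.univ (· ∈ K), Finset.filter_mem_eq_inter,
    Finset.univ_inter]
  congr 3
  ext S; simp

/-- The discarded mass is at most the whole: `‖M − Π_K M‖_F² ≤ ‖M‖_F²`. [cite: RudolphEtAl2025, Theory Box 3] -/
theorem frobSq_sub_truncateTo_le (K : Finset (ι → Pauli)) (M : Matrix (ι → Bool) (ι → Bool) ℂ) :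
    frobSq (M - truncateTo K M) ≤ frobSq M := by
  rw [frobSq_eq_frobSq_truncateTo_add K M]
  exact le_add_of_nonneg_left (frobSq_nonneg _)

/-! ### Weight truncation `𝒫_{≤ℓ}` -/

/-- The Pauli strings of Hamming weight at most `ℓ` (the labels kept by low-weight truncation).
[cite: SchusterEtAl2024, §2.2 ("the subspace of low-weight Pauli operators", `P : w[P] ≤ ℓ`)] -/
def lowWeight (ℓ : ℕ) : Finset (ι → Pauli) :=
  Finset.univ.filter fun S => strWeight S ≤ ℓ

/-- Membership in `lowWeight`. [cite: SchusterEtAl2024, §2.2] -/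
@[simp] theorem mem_lowWeight {ℓ : ℕ} {S : ι → Pauli} : S ∈ lowWeight ℓ ↔ strWeight S ≤ ℓ := by
  simp [lowWeight]

/-- **Low-weight truncation** `𝒫_{≤ℓ} M = Σ_{|S| ≤ ℓ} 2^{−n} Tr(S M) · S` — the tree's `truncateTo`
with the kept set `lowWeight ℓ`; `M − 𝒫_{≤ℓ} M = 𝒫_{>ℓ} M`.
[cite: SchusterEtAl2024, §2.2 (Õ^{(t)} = Σ_{P : w[P] ≤ ℓ} c̃_P P; 𝒫_{>ℓ} = Σ_{w>ℓ} 𝒫_w)] -/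
def truncWeight (ℓ : ℕ) (M : Matrix (ι → Bool) (ι → Bool) ℂ) : Matrix (ι → Bool) (ι → Bool) ℂ :=
  truncateTo (lowWeight ℓ) M

/-- Unfolding of `truncWeight`. [cite: SchusterEtAl2024, §2.2] -/
theorem truncWeight_eq (ℓ : ℕ) (M : Matrix (ι → Bool) (ι → Bool) ℂ) :
    truncWeight ℓ M = truncateTo (lowWeight ℓ) M := rfl

/-- Coefficients of `𝒫_{≤ℓ} M`: kept iff `|T| ≤ ℓ`. [cite: SchusterEtAl2024, §2.2] -/
theorem pauliCoeff_truncWeight (ℓ : ℕ) (M : Matrix (ι → Bool) (ι → Bool) ℂ) (T : ι → Pauli) :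
    pauliCoeff (truncWeight ℓ M) T = if strWeight T ≤ ℓ then pauliCoeff M T else 0 := by
  rw [truncWeight, pauliCoeff_truncateTo]
  simp only [mem_lowWeight]

/-- Coefficients of `𝒫_{>ℓ} M = M − 𝒫_{≤ℓ} M`: kept iff `|T| > ℓ`. [cite: SchusterEtAl2024, §2.2 (𝒫_{>ℓ})] -/
theorem pauliCoeff_sub_truncWeight (ℓ : ℕ) (M : Matrix (ι → Bool) (ι → Bool) ℂ) (T : ι → Pauli) :
    pauliCoeff (M - truncWeight ℓ M) T = if ℓ < strWeight T then pauliCoeff M T else 0 := by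
  rw [pauliCoeff_sub, pauliCoeff_truncWeight]
  by_cases h : strWeight T ≤ ℓ
  · rw [if_pos h, if_neg (not_lt.2 h), sub_self]
  · rw [if_neg h, if_pos (not_le.1 h), sub_zero]

/-- `‖𝒫_{>ℓ} M‖_F² = 4^{−n} Σ_{|S| > ℓ} |Tr(S M)|²`. [cite: SchusterEtAl2024, §2.2] -/
theorem frobSq_sub_truncWeight (ℓ : ℕ) (M : Matrix (ι → Bool) (ι → Bool) ℂ) :
    frobSq (M - truncWeight ℓ M) =
      ((4 : ℝ) ^ Fintype.card ι)⁻¹ * ∑ S ∈ Finset.univ.filter (fun S => ℓ < strWeight S),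
        ‖pauliCoeff M S‖ ^ 2 := by
  rw [truncWeight, frobSq_sub_truncateTo]
  congr 2
  ext S
  simp [lowWeight, not_le]

/-- The weight projection commutes with the noise layer (both are diagonal in the Pauli basis).
[cite: AharonovEtAl2023, §2 (Definition 2: ℰ^{⊗n}(S) = (1−γ)^{|S|} S)] -/
theorem truncWeight_depolarizeAll (γ : ℂ) (ℓ : ℕ) (M : Matrix (ι → Bool) (ι → Bool) ℂ) :
    truncWeight ℓ (depolarizeAll γ M) = depolarizeAll γ (truncWeight ℓ M) := by
  refine eq_of_forall_pauliCoeff_eq fun T => ?_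
  rw [pauliCoeff_truncWeight, pauliCoeff_depolarizeAll, pauliCoeff_depolarizeAll,
    pauliCoeff_truncWeight]
  split_ifs <;> simp

/-! ### One noise layer damps the high-weight mass -/

omit [Fintype ι] [DecidableEq ι] in
/-- `|(1−γ)^k| = (1−γ)^k` for a rate `γ ≤ 1` (real arithmetic inside `ℂ`). [folklore] -/
private theorem norm_one_sub_pow {γ : ℝ} (h1 : γ ≤ 1) (k : ℕ) :
    ‖((1 : ℂ) - (γ : ℂ)) ^ k‖ = (1 - γ) ^ k := by
  rw [norm_pow, ← Complex.ofReal_one, ← Complex.ofReal_sub, Complex.norm_real,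
    Real.norm_of_nonneg (sub_nonneg.2 h1)]

/-- Coefficient-wise damping: `|Tr(S ℰ^{⊗n}M)|² = (1−γ)^{2|S|} |Tr(S M)|²`.
[cite: AharonovEtAl2023, §2 (after Definition 2: f̃ = (1−γ)^{|s|} f)] -/
theorem norm_pauliCoeff_depolarizeAll_sq {γ : ℝ} (h1 : γ ≤ 1) (M : Matrix (ι → Bool) (ι → Bool) ℂ)
    (S : ι → Pauli) :
    ‖pauliCoeff (depolarizeAll (γ : ℂ) M) S‖ ^ 2 = (1 - γ) ^ (2 * strWeight S) * ‖pauliCoeff M S‖ ^ 2 := by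
  rw [pauliCoeff_depolarizeAll, norm_mul, mul_pow, norm_one_sub_pow h1, ← pow_mul, mul_comm (strWeight S)]

/-- The noise layer never increases the norm: `‖ℰ^{⊗n}(M)‖_F² ≤ ‖M‖_F²` for a rate `0 ≤ γ ≤ 1`
(each coefficient is multiplied by `(1−γ)^{|S|} ∈ [0,1]`).
[cite: AharonovEtAl2023, §2 (after Definition 2: f̃ = (1−γ)^{|s|} f)] -/
theorem frobSq_depolarizeAll_le {γ : ℝ} (h0 : 0 ≤ γ) (h1 : γ ≤ 1)
    (M : Matrix (ι → Bool) (ι → Bool) ℂ) : frobSq (depolarizeAll (γ : ℂ) M) ≤ frobSq M := by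
  rw [frobSq_eq_sum_pauliCoeff, frobSq_eq_sum_pauliCoeff]
  refine mul_le_mul_of_nonneg_left ?_ (by positivity)
  refine Finset.sum_le_sum fun S _ => ?_
  rw [norm_pauliCoeff_depolarizeAll_sq h1]
  refine mul_le_of_le_one_left (sq_nonneg _) ?_
  exact pow_le_one₀ (sub_nonneg.2 h1) (by linarith)

/-- **"A single application of uniform depolarizing noise damps the norm of any operator with weight
above `ℓ` by at least `e^{−γ(ℓ+1)}`"** — in the tree's rate convention (`e^{−γ_SYGY} = 1 − γ`):
`‖𝒫_{>ℓ} ℰ^{⊗n}(M)‖_F² ≤ (1−γ)^{2(ℓ+1)} ‖𝒫_{>ℓ} M‖_F²` for `0 ≤ γ ≤ 1`.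
[cite: SchusterEtAl2024, §2.2 (the sentence quoted; p. 6 of the arXiv text)] -/
theorem frobSq_depolarizeAll_sub_truncWeight_le {γ : ℝ} (h0 : 0 ≤ γ) (h1 : γ ≤ 1) (ℓ : ℕ)
    (M : Matrix (ι → Bool) (ι → Bool) ℂ) :
    frobSq (depolarizeAll (γ : ℂ) M - truncWeight ℓ (depolarizeAll (γ : ℂ) M)) ≤
      (1 - γ) ^ (2 * (ℓ + 1)) * frobSq (M - truncWeight ℓ M) := by
  rw [frobSq_sub_truncWeight, frobSq_sub_truncWeight, mul_left_comm]
  refine mul_le_mul_of_nonneg_left ?_ (by positivity)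
  rw [Finset.mul_sum]
  refine Finset.sum_le_sum fun S hS => ?_
  have hℓ : 2 * (ℓ + 1) ≤ 2 * strWeight S := Nat.mul_le_mul_left 2 (Finset.mem_filter.1 hS).2
  rw [norm_pauliCoeff_depolarizeAll_sq h1]
  exact mul_le_mul_of_nonneg_right (pow_le_pow_of_le_one (sub_nonneg.2 h1) (by linarith) hℓ)
    (sq_nonneg _)

/-! ### The computational-basis average is dominated by the Frobenius norm -/

/-- **Lemma 1 of Schuster–Yin–Gao–Yao for the computational-basis ensemble**: the mean over the
`2ⁿ` basis inputs of `|⟨x|A|x⟩|²` is at most `‖A‖_F²` (the diagonal is part of the matrix). With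
`A = O − Õ` this is "the root-mean-square difference between the expectation value of `O` and `Õ`
is less than `‖O − Õ‖_F`" for that ensemble. TODO(general form): low-average ensembles
(Supplementary §II of the source). [cite: SchusterEtAl2024, Lemma 1 (and §2: basis states are low-average)] -/
theorem avg_norm_diag_sq_le_frobSq (A : Matrix (ι → Bool) (ι → Bool) ℂ) :
    ((2 : ℝ) ^ Fintype.card ι)⁻¹ * ∑ x, ‖A x x‖ ^ 2 ≤ frobSq A := by
  rw [frobSq_eq]
  refine mul_le_mul_of_nonneg_left ?_ (by positivity)
  refine Finset.sum_le_sum fun x _ => ?_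
  exact Finset.single_le_sum (s := Finset.univ) (f := fun y => ‖A x y‖ ^ 2) (fun y _ => sq_nonneg (‖A x y‖))
    (Finset.mem_univ x)

/-- The same with the read-out written as `Tr(|x⟩⟨x| A)`. [cite: SchusterEtAl2024, Lemma 1] -/
theorem avg_norm_trace_proj_mul_sq_le_frobSq (A : Matrix (ι → Bool) (ι → Bool) ℂ) :
    ((2 : ℝ) ^ Fintype.card ι)⁻¹ * ∑ x, ‖(proj x * A).trace‖ ^ 2 ≤ frobSq A := by
  classical
  simp only [trace_proj_mul]
  exact avg_norm_diag_sq_le_frobSq A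

/-! ### The noisy Heisenberg operator `𝒞†{O}` -/

/-- The **noisy Heisenberg-evolved observable** of the layered circuit `U_0, …, U_{d−1}` with noise
rate `γ`: `heis γ U O = ℰ^{⊗n} 𝒰_0† ℰ^{⊗n} ⋯ 𝒰_{d−1}† ℰ^{⊗n} (O)`, `𝒰†(M) = U† M U` — the operator
`𝒞†{O}` with `tr(𝒞{ρ} O) = tr(ρ 𝒞†{O})` (`trace_heis_mul`); defined by peeling the LAST layer, to
match `noisyEvolve`. [cite: SchusterEtAl2024, §2.1 ("tr(𝒞{ρ}O) = tr(ρ 𝒞†{O})", the Heisenberg time-evolved observable)] -/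
def heis (γ : ℂ) : (d : ℕ) → (Fin d → Matrix (ι → Bool) (ι → Bool) ℂ) →
    Matrix (ι → Bool) (ι → Bool) ℂ → Matrix (ι → Bool) (ι → Bool) ℂ
  | 0, _, O => depolarizeAll γ O
  | d + 1, U, O =>
      heis γ d (fun i => U i.castSucc) ((U (Fin.last d))ᴴ * depolarizeAll γ O * U (Fin.last d))

/-- No layers: `𝒞†{O} = ℰ^{⊗n}(O)` (the read-out noise layer). [cite: SchusterEtAl2024, §2.1] -/
@[simp] theorem heis_zero_layers (γ : ℂ) (U : Fin 0 → Matrix (ι → Bool) (ι → Bool) ℂ)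
    (O : Matrix (ι → Bool) (ι → Bool) ℂ) : heis γ 0 U O = depolarizeAll γ O := rfl

/-- Peeling the last layer: `𝒞†_{d+1}{O} = 𝒞†_d{U_d† ℰ^{⊗n}(O) U_d}`. [cite: SchusterEtAl2024, §2.1 and §2.2 (update rule (c̃^{(t)}))] -/
theorem heis_succ_layers (γ : ℂ) {d : ℕ} (U : Fin (d + 1) → Matrix (ι → Bool) (ι → Bool) ℂ)
    (O : Matrix (ι → Bool) (ι → Bool) ℂ) :
    heis γ (d + 1) U O =
      heis γ d (fun i => U i.castSucc) ((U (Fin.last d))ᴴ * depolarizeAll γ O * U (Fin.last d)) := rfl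

/-- The noise layer is self-adjoint for the trace pairing: `Tr(A · ℰ^{⊗n} M) = Tr(ℰ^{⊗n} A · M)`
(both sides equal `2^{−n} Σ_S (1−γ)^{|S|} Tr(A S) Tr(S M)`).
[cite: AharonovEtAl2023, §2 (Definition 2; ℰ is diagonal in the self-dual Pauli basis)] -/
theorem trace_mul_depolarizeAll_comm (γ : ℂ) (A M : Matrix (ι → Bool) (ι → Bool) ℂ) :
    (A * depolarizeAll γ M).trace = (depolarizeAll γ A * M).trace := by
  rw [trace_mul_depolarizeAll, Matrix.trace_mul_comm (depolarizeAll γ A) M, trace_mul_depolarizeAll]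
  congr 1
  -- both sums are `Σ_S (1−γ)^{|S|} Tr(A S) Tr(S M)`
  have key : ∀ (B : Matrix (ι → Bool) (ι → Bool) ℂ) (S : ι → Pauli),
      (B * depolarizeAll γ (pauliString S)).trace = (1 - γ) ^ strWeight S * pauliCoeff B S := by
    intro B S
    rw [depolarizeAll_pauliString, Matrix.mul_smul, Matrix.trace_smul, smul_eq_mul, pauliCoeff_eq,
      Matrix.trace_mul_comm]
  simp only [key]
  refine Finset.sum_congr rfl fun S _ => ?_
  rw [pauliCoeff_eq A, pauliCoeff_eq M, Matrix.trace_mul_comm (pauliString S) A,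
    Matrix.trace_mul_comm (pauliString S) M]
  ring

/-- **`tr(𝒞{ρ} O) = tr(ρ 𝒞†{O})`**: the Heisenberg operator reproduces the noisy value of
`PauliPathIntegral.lean` for every input `ρ`. [cite: SchusterEtAl2024, §2.1 (first sentence)] -/
theorem trace_heis_mul (γ : ℂ) :
    ∀ {d : ℕ} (U : Fin d → Matrix (ι → Bool) (ι → Bool) ℂ) (ρ O : Matrix (ι → Bool) (ι → Bool) ℂ),
      (heis γ d U O * ρ).trace = noisyValue γ U ρ O
  | 0, U, ρ, O => by
      rw [heis_zero_layers, noisyValue, noisyEvolve_zero_layers, ← trace_mul_depolarizeAll_comm]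
  | d + 1, U, ρ, O => by
      rw [heis_succ_layers, trace_heis_mul γ (fun i => U i.castSucc) ρ, noisyValue, noisyValue,
        noisyEvolve_succ_layers, trace_mul_depolarizeAll_comm γ O]
      -- `Tr((U† ℰO U) · ℰ E) = Tr(ℰO · (U ℰE U†))` by cyclicity
      set E := depolarizeAll γ (noisyEvolve γ d (fun i => U i.castSucc) ρ)
      set V := U (Fin.last d)
      rw [show Vᴴ * depolarizeAll γ O * V * E = Vᴴ * (depolarizeAll γ O * V * E) by
            simp only [Matrix.mul_assoc],
        Matrix.trace_mul_comm, show depolarizeAll γ O * V * E * Vᴴ = depolarizeAll γ O * (V * E * Vᴴ) by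
            simp only [Matrix.mul_assoc]]

/-- In particular for the printed read-out `p̃_O(x)`-type quantity with input `|x⟩⟨x|`:
`noisyValue γ U (proj x) O = ⟨x|𝒞†{O}|x⟩`. [cite: SchusterEtAl2024, §2.1] -/
theorem noisyValue_proj_eq_heis_apply (γ : ℂ) {d : ℕ} (U : Fin d → Matrix (ι → Bool) (ι → Bool) ℂ)
    (O : Matrix (ι → Bool) (ι → Bool) ℂ) (x : ι → Bool) :
    noisyValue γ U (proj x) O = heis γ d U O x x := by
  classical
  rw [← trace_heis_mul, Matrix.trace_mul_comm, trace_proj_mul]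

/-- **The Heisenberg evolution is a contraction in `‖·‖_F`** for unitary layers and a rate
`0 ≤ γ ≤ 1`: `‖𝒞†{O}‖_F² ≤ ‖O‖_F²`. [cite: SchusterEtAl2024, §2.2 (noise damps, unitaries preserve the norm)] -/
theorem frobSq_heis_le {γ : ℝ} (h0 : 0 ≤ γ) (h1 : γ ≤ 1) :
    ∀ {d : ℕ} (U : Fin d → Matrix (ι → Bool) (ι → Bool) ℂ) (_hU : ∀ t, (U t)ᴴ * U t = 1)
      (O : Matrix (ι → Bool) (ι → Bool) ℂ), frobSq (heis (γ : ℂ) d U O) ≤ frobSq O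
  | 0, U, _, O => by simpa using frobSq_depolarizeAll_le h0 h1 O
  | d + 1, U, hU, O => by
      rw [heis_succ_layers]
      refine (frobSq_heis_le h0 h1 (fun i => U i.castSucc) (fun t => hU _) _).trans ?_
      rw [frobSq_conjTranspose_conj (hU _)]
      exact frobSq_depolarizeAll_le h0 h1 O

/-- **From a Frobenius bound to an input-averaged error bound**: for ANY approximant `Õ` of the
Heisenberg operator (e.g. a low-weight truncation), the mean squared error of the predicted values
over the computational-basis inputs is at most `‖𝒞†{O} − Õ‖_F²`:
`2^{−n} Σ_x |p̃(x) − Tr(Õ |x⟩⟨x|)|² ≤ ‖heis γ U O − Õ‖_F²`, `p̃(x) = noisyValue γ U |x⟩⟨x| O`.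
[cite: SchusterEtAl2024, Lemma 1 with §2.1 (the algorithm outputs tr(ρ Õ))] -/
theorem avg_sq_error_le_frobSq (γ : ℂ) {d : ℕ} (U : Fin d → Matrix (ι → Bool) (ι → Bool) ℂ)
    (O Otilde : Matrix (ι → Bool) (ι → Bool) ℂ) :
    ((2 : ℝ) ^ Fintype.card ι)⁻¹ * ∑ x, ‖noisyValue γ U (proj x) O - (Otilde * proj x).trace‖ ^ 2 ≤
      frobSq (heis γ d U O - Otilde) := by
  classical
  have h : ∀ x, noisyValue γ U (proj x) O - (Otilde * proj x).trace = (heis γ d U O - Otilde) x x := by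
    intro x
    rw [noisyValue_proj_eq_heis_apply, Matrix.trace_mul_comm, trace_proj_mul, Matrix.sub_apply]
  simp only [h]
  exact avg_norm_diag_sq_le_frobSq _

end PauliPath

end Literature.Computability.QuantumComplexity
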